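import Literature.Topology.FourManifolds.CobordismEndCollarMatching
import Literature.Topology.FourManifolds.ClosedAsCobordism
import Literature.Topology.FourManifolds.CollarCriterion
import HarnessLib

/-!
# Uniqueness of collars of `∂W`, ambient form: any two collars are matched by a diffeomorphism

Topic `Literature/Topology/FourManifolds`; a repackaging, for a compact manifold with boundary
`W` and its boundary manifold `∂W` (`BoundaryManifold.boundaryData`, `Cobordism.lean`), of the
tree's **ambient uniqueness of collars of an end of a cobordism**
(`Cobordism.exists_diffeomorph_comp_collar_eq_collar`, `CobordismEndCollarMatching.lean`:
Bröcker–Jänich, *Introduction to Differential Topology* (1982), (13.7) *"the collar of a compact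
boundary is unique up to diffeotopy"*; Hirsch, *Differential Topology* (1976), Ch. 8 §1,
Thm. 1.8; Kosinski, *Differential Manifolds* (1993), III (3.3) and the remark after (3.5)):

* `Cobordism.ofBoundaryIncoming n W` — the compact manifold with boundary `W` as a cobordism
  from `∂W` (incoming end, `inl = Subtype.val`) to the empty manifold `PEmpty` (the reverse of
  the tree's `Cobordism.ofBoundary n W = (W; ∅, ∂W)` of `SPC4HandlesCancelStep.lean`, restated
  here to spare that file's Morse-theoretic imports);
* `BoundaryManifold.exists_diffeomorph_comp_collar_eq_collar` — two collars of `∂W` given by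
  explicit data (a map `e : ∂W × ℝ → W` smooth on the slab `∂W × [0, ε)`, starting at the
  inclusion, with a smooth inverse on an open set) are matched near `∂W × {0}` by a
  self-diffeomorphism of `W` fixing `∂W` pointwise;
* `BoundaryData.OpenCollarData.exists_diffeomorph_apply_eq` — the same for two open collar data
  (`BoundaryData.OpenCollarData`, `CollarCriterion.lean`, the output of the flow-out
  construction `FlowoutInput.Cover.openCollarData`, `BoundaryFlowout.lean`) read at arbitrary
  positive speeds `λ₁`, `λ₂`: `Ψ (c₁ (m, λ₁ t)) = c₂ (m, λ₂ t)` for `0 ≤ t < δ`.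

This is Kosinski's remark (VI §5) that a construction along the boundary made with an interior
extension — a collar — *"does not depend on the choice of extensions … a version of the
Uniqueness of Collars Theorem"*, in the form consumed by the isotopy invariance of handle
attachment (`Geometry/Symplectic/TwoHandleIsotopy*.lean`).  Everything here is proved; the only
definition is the cobordism `Cobordism.ofBoundaryIncoming`; no named fact is introduced.

## References

* Th. Bröcker, K. Jänich, *Introduction to Differential Topology*, CUP (1982), (13.7).
  [BrockerJanich1982]
* M. W. Hirsch, *Differential Topology*, GTM 33 (1976), Ch. 8 §1, Thm. 1.8. [HirschDT1976]
* A. A. Kosinski, *Differential Manifolds*, Academic Press (1993), III (3.3), VI §5.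
  [Kosinski1993]
-/

open scoped Manifold ContDiff Topology
open Set Function

noncomputable section

namespace Literature.Topology.FourManifolds

/-! ### A compact manifold with boundary as a cobordism from its boundary to `∅` -/

section OfBoundary

variable (n : ℕ) (W : Type) [TopologicalSpace W] [T2Space W]
  [ChartedSpace (EuclideanHalfSpace (n + 1)) W] [IsManifold (𝓡∂ (n + 1)) ∞ W] [CompactSpace W]

/-- **A compact manifold with boundary as a cobordism from `∂W` to `∅`** (Milnor, *Lectures on
the h-cobordism theorem* (1965), §1: a triad `(W; V₀, V₁)` with `V₀ = ∂W`, `V₁ = ∅`): total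
space `W`, incoming end the boundary manifold `∂W` (`BoundaryManifold.chartedSpace`) included
by `Subtype.val` (`BoundaryManifold.isSmoothEmbedding_subtype_val`), outgoing end empty
(`PEmpty` with the empty atlas, the instance `instChartedSpacePEmpty` of
`ClosedAsCobordism.lean`, as for `Cobordism.ofClosed`). [cite: MilnorHCobordism1965, §1] -/
def Cobordism.ofBoundaryIncoming : Cobordism n (↥((𝓡∂ (n + 1)).boundary W)) PEmpty.{1} where
  W := W
  secondCountableTopology :=
    haveI : SecondCountableTopology (EuclideanHalfSpace (n + 1)) :=
      TopologicalSpace.Subtype.secondCountableTopology _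
    ChartedSpace.secondCountable_of_sigmaCompact (EuclideanHalfSpace (n + 1)) W
  inl := Subtype.val
  inr := PEmpty.elim
  isSmoothEmbedding_inl := BoundaryManifold.isSmoothEmbedding_subtype_val
  isSmoothEmbedding_inr := isSmoothEmbedding_of_isEmpty _
  disjoint_range := by
    rw [Set.range_eq_empty PEmpty.elim]
    exact disjoint_empty _
  range_inl_union_range_inr := by
    rw [Set.range_eq_empty PEmpty.elim, union_empty, Subtype.range_val]

/-- The total space of `Cobordism.ofBoundaryIncoming n W` is `W`. [folklore] -/
theorem Cobordism.ofBoundaryIncoming_W : (Cobordism.ofBoundaryIncoming n W).W = W := rfl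

/-- The incoming end of `Cobordism.ofBoundaryIncoming n W` is the inclusion of `∂W`. [folklore] -/
theorem Cobordism.ofBoundaryIncoming_inl :
    (Cobordism.ofBoundaryIncoming n W).inl = (Subtype.val : (𝓡∂ (n + 1)).boundary W → W) := rfl

end OfBoundary

/-! ### Two collars of `∂W` are matched by a diffeomorphism of `W` fixing `∂W` -/

section Matching

variable {n : ℕ} {W : Type} [TopologicalSpace W] [T2Space W]
  [ChartedSpace (EuclideanHalfSpace (n + 1)) W] [IsManifold (𝓡∂ (n + 1)) ∞ W] [CompactSpace W]

/-- **Any two collars of `∂W` are matched near `∂W` by a diffeomorphism of `W` fixing `∂W`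
pointwise** (Bröcker–Jänich (1982), (13.7); Hirsch (1976), Ch. 8 §1, Thm. 1.8): for two collars
`e₁`, `e₂ : ∂W × [0, εᵢ) → W` given by explicit data — `eᵢ` smooth on the slab
`∂W × [0, εᵢ)`, `eᵢ (m, 0) = m`, taking the slab into an open set `Uᵢ` carrying a smooth
inverse `einvᵢ` — there is a self-diffeomorphism `Ψ` of `W` with `Ψ m = m` on `∂W` and
`Ψ (e₁ (m, t)) = e₂ (m, t)` for all `m ∈ ∂W` and `t ∈ [0, δ)`, for some `δ > 0` with `δ ≤ ε₁`,
`δ ≤ ε₂`.  This is the tree's `Cobordism.exists_diffeomorph_comp_collar_eq_collar` for the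
cobordism `(W; ∂W, ∅)` (`Cobordism.ofBoundaryIncoming`). [cite: BrockerJanich1982, (13.7)] -/
theorem BoundaryManifold.exists_diffeomorph_comp_collar_eq_collar
    {ε₁ : ℝ} (hε₁ : 0 < ε₁) (e₁ : ↥((𝓡∂ (n + 1)).boundary W) × ℝ → W)
    (einv₁ : W → ↥((𝓡∂ (n + 1)).boundary W) × ℝ)
    (U₁ : Set W) (hU₁ : IsOpen U₁) (he₁0 : ∀ m, e₁ (m, 0) = m.val)
    (he₁s : ContMDiffOn ((𝓡 n).prod 𝓘(ℝ, ℝ)) (𝓡∂ (n + 1)) ∞ e₁ (univ ×ˢ Ico 0 ε₁))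
    (he₁U : MapsTo e₁ (univ ×ˢ Ico (0 : ℝ) ε₁) U₁)
    (hUe₁ : ∀ z ∈ U₁, einv₁ z ∈ (univ : Set ↥((𝓡∂ (n + 1)).boundary W)) ×ˢ Ico (0 : ℝ) ε₁ ∧
      e₁ (einv₁ z) = z)
    (hie₁ : ∀ q ∈ (univ : Set ↥((𝓡∂ (n + 1)).boundary W)) ×ˢ Ico (0 : ℝ) ε₁, einv₁ (e₁ q) = q)
    (hi₁s : ContMDiffOn (𝓡∂ (n + 1)) ((𝓡 n).prod 𝓘(ℝ, ℝ)) ∞ einv₁ U₁)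
    {ε₂ : ℝ} (hε₂ : 0 < ε₂) (e₂ : ↥((𝓡∂ (n + 1)).boundary W) × ℝ → W)
    (einv₂ : W → ↥((𝓡∂ (n + 1)).boundary W) × ℝ)
    (U₂ : Set W) (hU₂ : IsOpen U₂) (he₂0 : ∀ m, e₂ (m, 0) = m.val)
    (he₂s : ContMDiffOn ((𝓡 n).prod 𝓘(ℝ, ℝ)) (𝓡∂ (n + 1)) ∞ e₂ (univ ×ˢ Ico 0 ε₂))
    (he₂U : MapsTo e₂ (univ ×ˢ Ico (0 : ℝ) ε₂) U₂)
    (hUe₂ : ∀ z ∈ U₂, einv₂ z ∈ (univ : Set ↥((𝓡∂ (n + 1)).boundary W)) ×ˢ Ico (0 : ℝ) ε₂ ∧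
      e₂ (einv₂ z) = z)
    (hie₂ : ∀ q ∈ (univ : Set ↥((𝓡∂ (n + 1)).boundary W)) ×ˢ Ico (0 : ℝ) ε₂, einv₂ (e₂ q) = q)
    (hi₂s : ContMDiffOn (𝓡∂ (n + 1)) ((𝓡 n).prod 𝓘(ℝ, ℝ)) ∞ einv₂ U₂) :
    ∃ Ψ : W ≃ₘ⟮𝓡∂ (n + 1), 𝓡∂ (n + 1)⟯ W, (∀ m : (𝓡∂ (n + 1)).boundary W, Ψ m.val = m.val) ∧
      ∃ δ, 0 < δ ∧ δ ≤ ε₁ ∧ δ ≤ ε₂ ∧ ∀ m, ∀ t ∈ Ico 0 δ, Ψ (e₁ (m, t)) = e₂ (m, t) := by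
  obtain ⟨Ψ, -, hl, δ, hδ, hδ₁, hδ₂, h⟩ :=
    (Cobordism.ofBoundaryIncoming n W).exists_diffeomorph_comp_collar_eq_collar hε₁ e₁ einv₁ U₁ hU₁ he₁0
      he₁s he₁U hUe₁ hie₁ hi₁s hε₂ e₂ einv₂ U₂ hU₂ he₂0 he₂s he₂U hUe₂ hie₂ hi₂s
  exact ⟨Ψ, hl, δ, hδ, hδ₁, hδ₂, h⟩

end Matching

/-! ### Two open collar data of `∂W`, read at arbitrary positive speeds -/

section OpenCollarData

variable {n : ℕ} {W : Type} [TopologicalSpace W] [T2Space W]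
  [ChartedSpace (EuclideanHalfSpace (n + 2)) W] [IsManifold (𝓡∂ (n + 2)) ∞ W] [CompactSpace W]

namespace BoundaryData.OpenCollarData

variable (c : (BoundaryManifold.boundaryData (n + 1) W).OpenCollarData) {l : ℝ} (hl : 0 < l)

omit [T2Space W] [CompactSpace W] in
include hl in
/-- The open collar map read at speed `l > 0`, `(m, t) ↦ c (m, l t)`, is smooth on the slab
`∂W × [0, top / l)`. [folklore] -/
theorem contMDiffOn_speed :
    ContMDiffOn ((𝓡 (n + 1)).prod 𝓘(ℝ, ℝ)) (𝓡∂ (n + 2)) ∞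
      (fun q : ↥((𝓡∂ (n + 2)).boundary W) × ℝ => c.toFun q.1 (l * q.2))
      (univ ×ˢ Ico 0 (c.top / l)) := by
  have h : ContMDiff ((𝓡 (n + 1)).prod 𝓘(ℝ, ℝ)) ((𝓡 (n + 1)).prod 𝓘(ℝ, ℝ)) ∞
      (fun q : ↥((𝓡∂ (n + 2)).boundary W) × ℝ => (q.1, l * q.2)) :=
    contMDiff_fst.prodMk ((contDiff_const.mul contDiff_id).contMDiff.comp contMDiff_snd)
  refine c.contMDiffOn_toFun.comp h.contMDiffOn ?_
  rintro ⟨m, t⟩ ⟨-, ht⟩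
  refine ⟨mem_univ _, ?_, ?_⟩
  · exact mul_nonneg hl.le ht.1
  · have := ht.2
    rw [lt_div_iff₀ hl] at this
    linarith [mul_comm l t]

omit [T2Space W] [CompactSpace W] in
/-- The inverse `z ↦ (proj z, height z / l)` of the collar read at speed `l` is smooth on the
collar region. [folklore] -/
theorem contMDiffOn_inv_speed :
    ContMDiffOn (𝓡∂ (n + 2)) ((𝓡 (n + 1)).prod 𝓘(ℝ, ℝ)) ∞
      (fun z : W => (c.proj z, c.height z / l)) c.region :=
  c.contMDiffOn_proj.prodMk
    (((contDiff_id.div_const l).contMDiff).comp_contMDiffOn c.contMDiffOn_height)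

omit [T2Space W] [CompactSpace W] in
include hl in
/-- The collar read at speed `l` takes the slab `∂W × [0, top / l)` into the collar region.
[folklore] -/
theorem mapsTo_speed :
    MapsTo (fun q : ↥((𝓡∂ (n + 2)).boundary W) × ℝ => c.toFun q.1 (l * q.2))
      (univ ×ˢ Ico (0 : ℝ) (c.top / l)) c.region := by
  rintro ⟨m, t⟩ ⟨-, ht⟩
  refine c.mem_region m _ ⟨mul_nonneg hl.le ht.1, ?_⟩
  have := ht.2
  rw [lt_div_iff₀ hl] at this
  linarith [mul_comm l t]

/-- **Two open collar data of `∂W`, read at any positive speeds, are matched near `∂W` by a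
diffeomorphism of `W` fixing `∂W` pointwise** (uniqueness of collars, Bröcker–Jänich (1982),
(13.7); Kosinski (1993), VI §5: *"… not on the choice of extensions … a version of the
Uniqueness of Collars Theorem"*): for `c₁`, `c₂` open collar data of the boundary datum `∂W`
(`BoundaryData.OpenCollarData`, e.g. two flow-outs `FlowoutInput.Cover.openCollarData`) and
speeds `l₁, l₂ > 0` there are a self-diffeomorphism `Ψ` of `W` with `Ψ = id` on `∂W` and
`δ > 0` with `Ψ (c₁ (m, l₁ t)) = c₂ (m, l₂ t)` for all `m ∈ ∂W`, `t ∈ [0, δ)`.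
[cite: BrockerJanich1982, (13.7)] [cite: Kosinski1993, VI §5] -/
theorem exists_diffeomorph_apply_eq
    (c₁ c₂ : (BoundaryManifold.boundaryData (n + 1) W).OpenCollarData)
    {l₁ : ℝ} (hl₁ : 0 < l₁) {l₂ : ℝ} (hl₂ : 0 < l₂) :
    ∃ Ψ : W ≃ₘ⟮𝓡∂ (n + 2), 𝓡∂ (n + 2)⟯ W, (∀ m : (𝓡∂ (n + 2)).boundary W, Ψ m.val = m.val) ∧
      ∃ δ, 0 < δ ∧ ∀ m, ∀ t ∈ Ico 0 δ, Ψ (c₁.toFun m (l₁ * t)) = c₂.toFun m (l₂ * t) := by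
  -- the two collars as explicit data at the given speeds
  have key := BoundaryManifold.exists_diffeomorph_comp_collar_eq_collar (n := n + 1) (W := W)
    (div_pos c₁.top_pos hl₁)
    (fun q : ↥((𝓡∂ (n + 2)).boundary W) × ℝ => c₁.toFun q.1 (l₁ * q.2))
    (fun z : W => (c₁.proj z, c₁.height z / l₁)) c₁.region c₁.isOpen_region
    (fun m => by simp only [mul_zero, c₁.apply_zero]; rfl)
    (c₁.contMDiffOn_speed hl₁) (c₁.mapsTo_speed hl₁)
    (fun z hz => ?_) (fun q hq => ?_) c₁.contMDiffOn_inv_speed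
    (div_pos c₂.top_pos hl₂)
    (fun q : ↥((𝓡∂ (n + 2)).boundary W) × ℝ => c₂.toFun q.1 (l₂ * q.2))
    (fun z : W => (c₂.proj z, c₂.height z / l₂)) c₂.region c₂.isOpen_region
    (fun m => by simp only [mul_zero, c₂.apply_zero]; rfl)
    (c₂.contMDiffOn_speed hl₂) (c₂.mapsTo_speed hl₂)
    (fun z hz => ?_) (fun q hq => ?_) c₂.contMDiffOn_inv_speed
  · obtain ⟨Ψ, hΨ, δ, hδ, -, -, h⟩ := key
    exact ⟨Ψ, hΨ, δ, hδ, h⟩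
  -- the four inversion identities
  · have hh := c₁.height_mem z hz
    refine ⟨⟨mem_univ _, div_nonneg hh.1 hl₁.le, div_lt_div_of_pos_right hh.2 hl₁⟩, ?_⟩
    show c₁.toFun (c₁.proj z) (l₁ * (c₁.height z / l₁)) = z
    rw [mul_div_cancel₀ _ hl₁.ne']
    exact c₁.apply_proj_height z hz
  · obtain ⟨m, t⟩ := q
    obtain ⟨-, ht⟩ := hq
    have hlt : l₁ * t ∈ Ico 0 c₁.top := by
      refine ⟨mul_nonneg hl₁.le ht.1, ?_⟩
      have := ht.2; rw [lt_div_iff₀ hl₁] at this; linarith [mul_comm l₁ t]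
    show (c₁.proj (c₁.toFun m (l₁ * t)), c₁.height (c₁.toFun m (l₁ * t)) / l₁) = (m, t)
    refine Prod.ext (c₁.proj_apply m _ hlt) ?_
    show c₁.height (c₁.toFun m (l₁ * t)) / l₁ = t
    rw [c₁.height_apply m _ hlt, mul_div_cancel_left₀ _ hl₁.ne']
  · have hh := c₂.height_mem z hz
    refine ⟨⟨mem_univ _, div_nonneg hh.1 hl₂.le, div_lt_div_of_pos_right hh.2 hl₂⟩, ?_⟩
    show c₂.toFun (c₂.proj z) (l₂ * (c₂.height z / l₂)) = z
    rw [mul_div_cancel₀ _ hl₂.ne']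
    exact c₂.apply_proj_height z hz
  · obtain ⟨m, t⟩ := q
    obtain ⟨-, ht⟩ := hq
    have hlt : l₂ * t ∈ Ico 0 c₂.top := by
      refine ⟨mul_nonneg hl₂.le ht.1, ?_⟩
      have := ht.2; rw [lt_div_iff₀ hl₂] at this; linarith [mul_comm l₂ t]
    show (c₂.proj (c₂.toFun m (l₂ * t)), c₂.height (c₂.toFun m (l₂ * t)) / l₂) = (m, t)
    refine Prod.ext (c₂.proj_apply m _ hlt) ?_
    show c₂.height (c₂.toFun m (l₂ * t)) / l₂ = t
    rw [c₂.height_apply m _ hlt, mul_div_cancel_left₀ _ hl₂.ne']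

end BoundaryData.OpenCollarData

end OpenCollarData

end Literature.Topology.FourManifolds

end
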